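import Literature.IUT.HodgeArakelov.ThetaSettingCor112ModelTateOfKerNeBot
import Literature.IUT.HodgeArakelov.ThetaSettingModelTateProfiniteInnerAut
import Literature.IUT.HodgeArakelov.ThetaSettingModelTateExoticDatum
import Literature.AnabelianGeometry.EtaleTheta.SettingModelTatePairKernelNontrivial
import HarnessLib

/-!
# The (R1) UNIQUENESS binder `huniq` of the [IUTchII] Cor. 1.12 (ii)(iii) instance of record is UNSATISFIABLE at the stage-2
# Tate model (proof-only; K-L6 row «HUNIQ-REFUTED-AT-MODEL», file 2: the refutation, at the instance's own `let`-prefix)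

S. Mochizuki, *Inter-universal Teichmüller theory II*, §1, Remark 1.4.1 (ii) (kurims p. 28: «the unique order two
`Δ^tp_{X̲̲_k}`-outer automorphism of `Π^tp_{X̲̲_k}` over `G_k`»), Cor. 1.12 (ii)(iii) pp. 56–58 [claim: Mochizuki2012, status:
disputed]; [EtTh] §2 p. 36, Def. 2.5 (i) p. 39 [cite: MochizukiEtTh2009, Def 2.5 (i) p.39]; [SemiAnbd] Lem. 6.1 (i) p. 69
[cite: MochizukiSemiAnbd2006, Lem 6.1(i) p.69].  Cell `abc-iut`, seat abc-iut-L6-d2 (gen 9).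

THE BINDER.  abc-iut-w4-d043 / abc-iut-w4-d008's instance of record `ModelTateCarriers.cor112_model_modelTate_section_translates_of_ker_ne_bot`
(p488290) displays the K-L6 cell `IUTchII:Cor1.12(ii)(iii)@modelTate` with residual `∀`-binders {`hP`, `h218i₁`, `hcharY`, `huniq`, `G`}
(`hI0` being abc-iut-w4-d044's theorem p488367).  Its (R1) binder is, verbatim,
`huniq : ∀ κ : Π ≃ₜ* Π, (κ over G through Env₀) → (κ² Δ-inner) → (κ not Δ-inner) → (κ is Δ-conjugate to α)`,
`Π := Π^tp_{X̲̲}` of the `X̲̲`-choice of record, `Env₀ :=` the genuine B8 Prop. 1.2 (i) output at the identification `hP`,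
`α :=` the stage-2 inversion restricted to `Π^tp_{X̲̲}`.

THE RESULT `not_huniq_modelTate`.  For EVERY identification `hP` that binder is FALSE at the model: the exotic automorphism
`κ := α ∘ Ad(A)|_{Π^tp_{X̲̲}}` of file 1 (`exists_profiniteInner`, `exists_exoticDatum`: `A := (η a^l)^v`, `ĥ_l(A) = 1`, `σ̂ A = A⁻¹`,
`ê(A) = v^l ∉ ι(ℤ)`) is over `G` through `Env₀` — because `Env₀.projG ∘ isoX` is the quotient by `Ker(aug)` after the arbitrary
identification `hP.some`, which PRESERVES `Ker(aug) = Δ` by the MChar THEOREM of abc-iut-w4-d044 (p486362 ∘ p488367), so no F-0620 is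
needed —, satisfies `κ ∘ κ = id` (hence «`κ²` `Δ`-inner» with `δ' := 1`), is not `Δ`-inner (it reverses the degree `Π^tp_X ↠ ℤ`), and
is NOT `Δ`-conjugate to `α` (else `Ad(A)` would be inner on `Π^tp_{X̲̲}`, impossible as `ê(A) ∉ ι(ℤ)`).  By-product
`projG_isoX_envOfGroup_eq_one_iff_aug_modelTate`: abc-iut-w4-d010's identification datum `hEnv` holds at the model for every `hP`
WITHOUT F-0620 (so p488290's `hover` no longer depends on `h218i₁` either).

K-L6 READING (honest words).  At OUR semi-synthetic Tate model the typed (R1) uniqueness clause admits NO instantiation: the instance of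
record is VACUOUS in its `huniq` binder there.  The cause is a NON-GENUINE feature of the model (`Π^tp_X` is normalised by all of
`F̂₂` in `Π_X`; print's `Π^tp_X` is its own normaliser, [SemiAnbd] Lem. 6.1 (i)) — NOT a statement about print's Rmk. 1.4.1 (ii),
whose uniqueness concerns the tempered fundamental group of the actual curve.  A REPAIRED binder the model could meet must restrict
`κ` (e.g. to automorphisms that do not extend to `Π_X`-inner ones / that respect the Heisenberg level structure `ĥ_N` for all `N`);
the repair is the planner's call.  refuted-at-a-model ≠ refuted-in-print; no side taken on [IUTchIII] Cor. 3.12; typed ≠ proved;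
nothing here asserts abc proved or refuted.
-/

set_option autoImplicit false

noncomputable section

namespace Literature.IUT.HodgeArakelov

open Literature.AnabelianGeometry.AbsoluteAnabelian
open Literature.AnabelianGeometry.EtaleTheta Literature.AnabelianGeometry.SemiGraphs CohomologySystemOfContH1
open Literature.AnabelianGeometry.EtaleTheta.SettingModel
open Literature.NumberTheory.GaloisRepresentations
open scoped Literature.AnabelianGeometry.EtaleTheta
open EtaleThetaDataOfSetting

/-! ## §1. `hEnv` at the model WITHOUT F-0620: `projG (isoX y) = 1 ↔ aug y = 1`, every `hP` -/

namespace EtaleThetaDataOfSetting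

variable (p : ℕ) [Fact p.Prime] (i j : ℤ) (hj : Even j)
  {ED : (ThetaSetting.modelχq p i j hj).EtaleThetaData} {l : ℕ} (C : ED.DoubleUnderline l) {N : ℕ+}
  (μ : (ThetaSetting.modelχq p i j hj).CyclotomeMod l N) (hC : (ThetaSetting.modelχq p i j hj).Compat)
  (hS : (ThetaSetting.modelχq p i j hj).Sec2Hyps) (h15 : ThetaSetting.Prop15iii ED hC) (L : C.CuspLabels) (hl : l.Prime)
  (hp2 : p ≠ 2) (hpl : p ≠ l) (hζ : ∃ ζ : (ThetaSetting.modelχq p i j hj).K, IsPrimitiveRoot ζ (4 * l))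
  {η : (C.thetaEnvData μ hC hS).PiYdd → MuN p N} (hη : η ∈ (C.thetaEnvData μ hC hS).thetaCocycles)
  (hZ : Nonempty (ModelCyclotomes.lDeltaQuot (C.rigidData μ hC hS h15 L) ≃* Literature.IUT.HodgeTheaters.ZHat))
  (hP : Nonempty ((Pi C) ≃ₜ* (ThetaSetting.ofDoubleUnderline C μ hC hS hl hp2 hpl hζ hη).PiX))

/-- **`hEnv` at the stage-2 Tate model, UNCONDITIONALLY**: for every `X̲̲`-choice `C` over `modelχq p i j` and every identification
`hP`, the genuine Prop. 1.2 (i) output `Env₀ := envOfGroup …` has `Env₀.projG (Env₀.isoX y) = 1 ↔ aug y = 1`.  abc-iut-w4-d010's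
`projG_isoX_envOfGroup_eq_one_iff_aug_of_cor218_i` used [EtTh] Cor. 2.18 (i) only to know that the arbitrary automorphism `hP.some`
preserves `Ker(aug) = Δ`; at the model that is abc-iut-w4-d044's MChar THEOREM (p486362 `…_of_ker_ne_bot'` ∘ p488367
`ker_tatePairHom_ne_bot`). [claim: Mochizuki2012, status: disputed] (IUTchII §1 Prop 1.2 (i), kurims p.25) -/
theorem projG_isoX_envOfGroup_eq_one_iff_aug_modelTate (y : Pi C) :
    (ThetaSetting.envOfGroup (C.rigidData μ hC hS h15 L)
          (ThetaSetting.SideData.ofDoubleUnderline C μ hC hS hl hp2 hpl hζ hη) (ThetaSetting.t1Space_Huu C)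
          (ThetaSetting.isClosed_ker_aug_thetaEnvData C μ hC hS) hZ (Pi C) hP).recon.projG
        ((ThetaSetting.envOfGroup (C.rigidData μ hC hS h15 L)
          (ThetaSetting.SideData.ofDoubleUnderline C μ hC hS hl hp2 hpl hζ hη) (ThetaSetting.t1Space_Huu C)
          (ThetaSetting.isClosed_ker_aug_thetaEnvData C μ hC hS) hZ (Pi C) hP).isoX y) = 1 ↔
      (ThetaSetting.modelχq p i j hj).aug (y : (ThetaSetting.modelχq p i j hj).PiTemp) = 1 := by
  have hΔ := SettingModel.deltaX_characteristic_ofDoubleUnderline_modelχq_of_ker_ne_bot' p i j hj C μ hC hS hl hp2 hpl hζ hη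
    (SettingModel.ker_tatePairHom_ne_bot p i j) hP.some
  -- membership in `Δ` of the setting is `aug = 1`
  have hmem : ∀ z : Pi C, z ∈ (ThetaSetting.ofDoubleUnderline C μ hC hS hl hp2 hpl hζ hη).DeltaX ↔
      (ThetaSetting.modelχq p i j hj).aug (z : (ThetaSetting.modelχq p i j hj).PiTemp) = 1 := fun z =>
    (ThetaSetting.mem_deltaX_ofDoubleUnderline_iff C μ hC hS hl hp2 hpl hζ hη z).trans Iff.rfl
  show (QuotientGroup.mk' (C.rigidData μ hC hS h15 L).aug.ker) (hP.some y) = 1 ↔ _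
  rw [QuotientGroup.mk'_apply, QuotientGroup.eq_one_iff, mem_augKer_rigidData_iff, ← hmem, ← hmem]
  exact (mem_iff_apply_mem_of_map_eq hP.some.toMulEquiv _ hΔ y).symm

end EtaleThetaDataOfSetting

/-! ## §2. The refutation of `huniq` at the instance of record -/

namespace ModelTateCarriers

variable (p : ℕ) [Fact p.Prime] (l : ℕ+) (hl : Odd (l : ℕ)) (hlp : (l : ℕ).Prime) (hdvd : 4 * (l : ℕ) ∣ p - 1)
  {Es : Set ℕ+} (τ : (ThetaSetting.modelχq p 1 2 even_two).CyclotomeTower l Es)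

/-- **The (R1) binder `huniq` of `cor112_model_modelTate_section_translates_of_ker_ne_bot` (p488290) is FALSE at the stage-2 Tate
model, for EVERY identification `hP`** — stated at that theorem's own `let`-prefix (`hC`, `hS`, `ι := inversionχq p 1 2`, the
`X̲̲`-choice of record `C`, the root cocycle `f`, `h15`, the empty labelling `L`, `hp2 hpl hζ hZ`, then `∀ hP`, `Env₀`, `hι`,
`α := inversionAlpha C ι hι`), with the binder's text VERBATIM under the negation.  Witness: `κ := α ∘ Ad(A)|_{Π^tp_{X̲̲}}` for the
exotic datum `A` of `ThetaSettingModelTateExoticDatum` (file 1: over `G`, `κ ∘ κ = id`, degree-reversing, and `Ad(A)` not inner).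
[claim: Mochizuki2012, status: disputed] (IUTchII §1 Rmk 1.4.1 (ii), kurims p.28) -/
theorem not_huniq_modelTate :
    -- the [EtTh] §1 data of record at the Tate model (as in p488290)
    let hC := compat_modelχq p 1 2 even_two
    let hS := ThetaSetting.modelχq_sec2Hyps p 1 2 even_two
    let ι := inversionχq p 1 2
    let K₀ := (kummerCoreχq p 1 2 even_two).toKummerDataOfSection SemidirectProduct.inr (continuous_inrχq p 1 2)
        (fun _ => rfl) (map_inr_GK_le_GtpY_modelχq' p 1 2 even_two) (map_inr_GKdd_le_GtpYdd_modelχq' p 1 2 even_two)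
    let C := (K₀.etaleThetaDataOfClass (etaDdχq p 1 2 even_two)).doubleUnderlineχqOfEtaRes p 1 2 l hl
        (eta_res_etaDdχq p 1 2 even_two l hl)
    let f := EtaleThetaDataOfSetting.rootLift C
    let hf : f ∈ C.rootCocycles hC := rootLift_mem_rootCocycles C hC
    let h15 : Literature.AnabelianGeometry.EtaleTheta.ThetaSetting.Prop15iii _ hC :=
      prop15iii_etaleThetaDataOfClass_etaDdχq p hC SemidirectProduct.inr
        (continuous_inrχq p 1 2) (fun _ => rfl) (map_inr_GK_le_GtpY_modelχq' p 1 2 even_two)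
        (map_inr_GKdd_le_GtpYdd_modelχq' p 1 2 even_two)
    let L : C.CuspLabels := ⟨fun _ => ∅, fun _ => ∅, fun _ => rfl⟩
    let hO := ThetaSetting.modelχq_isEtThOrigin p 1 2 even_two
    let hYcl := hYcl_modelχq p 1 2 even_two
    let hp2 := ne_two_of_four_mul_dvd_pred p l.pos hdvd
    let hpl := ne_of_four_mul_dvd_pred p l.pos hdvd
    let hζ := exists_isPrimitiveRoot_K_modelχq p 1 2 even_two l.pos hdvd
    let hZ : ∀ M : ℕ+, Nonempty (ModelCyclotomes.lDeltaQuot (C.rigidData (τ.modAll M) hC hS h15 L) ≃*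
        Literature.IUT.HodgeTheaters.ZHat) := fun M =>
      ModelCyclotomes.nonempty_lDeltaQuot_rigidData_mulEquiv_zHat C (τ.modAll M) hC hS h15 L hO hYcl hlp.ne_zero
    ∀ (hP : Nonempty ((EtaleThetaDataOfSetting.Pi C) ≃ₜ* (EtaleLevels.setting C hC hS hlp hp2 hpl hζ τ.modAll f hf).PiX)),
    let Env₀ : EnvOfGroup (EtaleLevels.setting C hC hS hlp hp2 hpl hζ τ.modAll f hf)
        (EtaleLevels.modelSystem C hC hS hlp hp2 hpl hζ τ.modAll f hf τ.red_modAll h15 L hZ).PiX :=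
      ThetaSetting.envOfGroup (C.rigidData (τ.modAll 1) hC hS h15 L)
        (ThetaSetting.SideData.ofDoubleUnderline C (τ.modAll 1) hC hS hlp hp2 hpl hζ (EtaleLevels.eta0_mem C hC hS τ.modAll f hf 1))
        (ThetaSetting.t1Space_Huu C) (ThetaSetting.isClosed_ker_aug_thetaEnvData C (τ.modAll 1) hC hS) (hZ 1)
        (EtaleThetaDataOfSetting.Pi C) hP
    let hι : C.Huu.map ι.toMulEquiv.toMonoidHom = C.Huu := map_Huuχq_inversionχq p 1 2 l hl
    let α : (EtaleThetaDataOfSetting.Pi C) ≃ₜ* (EtaleThetaDataOfSetting.Pi C) := EtaleThetaDataOfSetting.inversionAlpha C ι hι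
    ¬ (∀ κ : (EtaleThetaDataOfSetting.Pi C) ≃ₜ* (EtaleThetaDataOfSetting.Pi C),
        (∀ x, Env₀.recon.projG (Env₀.isoX (κ x)) = Env₀.recon.projG (Env₀.isoX x)) →
        (∃ δ' : EtaleThetaDataOfSetting.Pi C, Env₀.recon.projG (Env₀.isoX δ') = 1 ∧ ∀ x, κ (κ x) = δ' * x * δ'⁻¹) →
        (¬ ∃ δ' : EtaleThetaDataOfSetting.Pi C, Env₀.recon.projG (Env₀.isoX δ') = 1 ∧ ∀ x, κ x = δ' * x * δ'⁻¹) →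
          ∃ δ' : EtaleThetaDataOfSetting.Pi C, Env₀.recon.projG (Env₀.isoX δ') = 1 ∧ ∀ x, κ x = δ' * α x * δ'⁻¹) := by
  intro hC hS ι K₀ C f hf h15 L hO hYcl hp2 hpl hζ hZ hP Env₀ hι α huniq
  -- the exotic datum and the profinite-inner automorphism `φ = Ad(A)|_{Π^tp_X}`
  obtain ⟨A, hA, hσA, hA'⟩ := SettingModel.exists_exoticDatum l
  obtain ⟨φ, hφ⟩ := SettingModel.exists_profiniteInner p 1 2 A
  -- `φ` and `ι ∘ φ` stabilise `Π^tp_{X̲̲} = C.Huu = Huuχq p 1 2 l hl`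
  have hφH : C.Huu.map φ.toMulEquiv.toMonoidHom = C.Huu := SettingModel.map_Huuχq_of_toHat_eq hφ l hl hA
  have hψH : C.Huu.map (φ.trans ι).toMulEquiv.toMonoidHom = C.Huu := by
    change C.Huu.map (ι.toMulEquiv.toMonoidHom.comp φ.toMulEquiv.toMonoidHom) = C.Huu
    rw [← Subgroup.map_map, hφH]
    exact hι
  -- the witness `κ := (ι ∘ φ)|_{Π^tp_{X̲̲}}`
  let κ : (EtaleThetaDataOfSetting.Pi C) ≃ₜ* (EtaleThetaDataOfSetting.Pi C) :=
    EtaleThetaDataOfSetting.inversionAlpha C (φ.trans ι) hψH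
  have hκ : ∀ x : EtaleThetaDataOfSetting.Pi C,
      ((κ x : EtaleThetaDataOfSetting.Pi C) : PiTpχq p 1 2) = ι (φ (x : PiTpχq p 1 2)) := fun x => rfl
  have hα : ∀ x : EtaleThetaDataOfSetting.Pi C,
      ((α x : EtaleThetaDataOfSetting.Pi C) : PiTpχq p 1 2) = ι (x : PiTpχq p 1 2) := fun x => rfl
  have hιι : ∀ y : PiTpχq p 1 2, ι (ι y) = y := inversionχq_inversionχq p 1 2
  have hcoe : ∀ a b : EtaleThetaDataOfSetting.Pi C,
      ((a * b : EtaleThetaDataOfSetting.Pi C) : PiTpχq p 1 2) = (a : PiTpχq p 1 2) * (b : PiTpχq p 1 2) :=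
    fun _ _ => rfl
  have hinv : ∀ a : EtaleThetaDataOfSetting.Pi C,
      ((a⁻¹ : EtaleThetaDataOfSetting.Pi C) : PiTpχq p 1 2) = (a : PiTpχq p 1 2)⁻¹ := fun _ => rfl
  -- (1) `κ` is over `G` through `Env₀` (no F-0620: the MChar theorem, §1)
  have h1 : ∀ x, Env₀.recon.projG (Env₀.isoX (κ x)) = Env₀.recon.projG (Env₀.isoX x) := by
    intro x
    rw [← inv_mul_eq_one, ← map_inv, ← map_mul, ← map_inv, ← map_mul]
    refine (EtaleThetaDataOfSetting.projG_isoX_envOfGroup_eq_one_iff_aug_modelTate p 1 2 even_two C (τ.modAll 1) hC hS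
      h15 L hlp hp2 hpl hζ (EtaleLevels.eta0_mem C hC hS τ.modAll f hf 1) (hZ 1) hP ((κ x)⁻¹ * x)).2 ?_
    show augχq p 1 2 ((ι (φ (x : PiTpχq p 1 2)))⁻¹ * (x : PiTpχq p 1 2)) = 1
    rw [map_mul, map_inv]
    change (ι (φ (x : PiTpχq p 1 2))).right⁻¹ * (x : PiTpχq p 1 2).right = 1
    rw [show (ι (φ (x : PiTpχq p 1 2))).right = (φ (x : PiTpχq p 1 2)).right from rfl,
      SettingModel.right_eq_of_toHat_eq hφ, inv_mul_cancel]
  -- (2) `κ ∘ κ = id`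
  have h2 : ∃ δ' : EtaleThetaDataOfSetting.Pi C, Env₀.recon.projG (Env₀.isoX δ') = 1 ∧ ∀ x, κ (κ x) = δ' * x * δ'⁻¹ := by
    refine ⟨1, EtaleThetaDataOfSetting.projG_isoX_envOfGroup_one C (τ.modAll 1) hC hS h15 L hlp hp2 hpl hζ
      (EtaleLevels.eta0_mem C hC hS τ.modAll f hf 1) (hZ 1) hP, fun x => ?_⟩
    rw [one_mul, inv_one, mul_one]
    apply Subtype.ext
    rw [hκ, hκ]
    exact SettingModel.inversionχq_apply_inversionχq_apply_of_toHat_eq hφ hσA _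
  -- (3) `κ` is not `Δ`-inner (indeed not inner at all): it reverses the degree
  have h3 : ¬ ∃ δ' : EtaleThetaDataOfSetting.Pi C, Env₀.recon.projG (Env₀.isoX δ') = 1 ∧ ∀ x, κ x = δ' * x * δ'⁻¹ := by
    rintro ⟨δ', -, hδ'⟩
    refine SettingModel.not_inner_inversionχq_comp_of_toHat_eq p 1 2 hφ l hl (δ' : PiTpχq p 1 2) fun h hh => ?_
    have key := congrArg (fun y : EtaleThetaDataOfSetting.Pi C => (y : PiTpχq p 1 2)) (hδ' ⟨h, hh⟩)
    simp only [hκ, hcoe, hinv] at key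
    exact key
  -- (4) the conclusion fails: `κ = Ad(δ') ∘ α` would make `Ad(A)|` inner on `Π^tp_{X̲̲}`
  obtain ⟨δ', -, hδ'⟩ := huniq κ h1 h2 h3
  refine SettingModel.not_inner_of_toHat_eq p 1 2 hφ l hl hA' (ι (δ' : PiTpχq p 1 2)) fun h hh => ?_
  have key := congrArg (fun y : EtaleThetaDataOfSetting.Pi C => ι (y : PiTpχq p 1 2)) (hδ' ⟨h, hh⟩)
  simp only [hκ, hα, hcoe, hinv, map_mul, map_inv, hιι] at key
  exact key

end ModelTateCarriers

end Literature.IUT.HodgeArakelov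

end
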